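/-
Width seat `ym-line-sgb-p1-w3` (gen 2, seat prover-ym-line-sgb-p1-w3-g2-0), route `SteinGapBootstrap`, crux `ProbeCovFromPairLawG`
(stmt-QuantumFields-23640) — file 3/3: the route decl BY NAME.
-/
import Summits.QuantumFields.YangMills.Theses.SteinGapBootstrap
import Summits.QuantumFields.YangMills.Theorems.SteinGapBootstrapProbeCovFromPairLawGAxis
import Summits.QuantumFields.YangMills.Theorems.SteinGapBootstrapProbeCovFromPairLawGTest
import HarnessLib

/-!
# Route `SteinGapBootstrap`, crux `ProbeCovFromPairLawG` (stmt-QuantumFields-23640) — PROVED (δ = 1/2)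

NOT THE CLAY GAP: the route bears on the RECORD-label rung leaf R2ξ′ `WeakCouplingRates.XiPow`, an UPPER bound on the lattice mass
gap of torus-limit states; this crux is the probe-from-pair-law step of the Stein line and proves no summit statement.

PROBE COVARIANCE FROM THE PAIR LAW, UNDER EQUIPARTITION.  For every compact simple `G`, faithful unitary `r` and `C₀` there are
`δ = 1/2`, `C`, `β₀ = 1` such that for `β ≥ β₀`, every torus-limit state `μ` with plaquette energies `∫(N − Re tr r(U_p))dμ ≤ C₀/β`,
every `n ≥ 1` and `η ≥ 0`: if the law under `μ` of the rescaled comb-gauge pair plaquette field `Y^β_B`, `B = {(0;1,2), (n e₀;1,2)}`,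
is `η`-close to the lattice-Maxwell block law `γ_B` on smooth test functions with `‖∇h‖ ≤ 1`, `‖∇²h‖ ≤ 1`, then
`|Cov_μ(P, P∘α_n) − 2^{-D}((1 − c_n²)^{-D/2} − 1)| ≤ Cη + Cβ^{-1/2}`, `P = exp(-2(β(N − Re tr r(U_{(0;1,2)})))₊)`, `D = dim G`.

Proof.  (1) Both plaquettes of `B` lie on the time axis, where the comb gauge makes the probe a function of the field up to the
tangency defect: `∫|P_x − exp(-|Y_{(x;1,2)}|²)| dμ ≤ √K C₀ β^{-1/2}` (`ProbeCovFromPairLaw.integral_abs_probe_sub_gauss_le`), and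
`P∘α_n = P_{n e₀}` (`plaquetteObs_timeShiftLG`); products and products of means move by at most twice that (all factors in `[0,1]`).
(2) The Gaussians `exp(-|y_{p}|²)` and `exp(-|y_{p₀}|² − |y_{p_n}|²)`, divided by `6D+1`, `12D+1`, are admissible test functions
(`gaussTest_admissible`), so their `μ`-expectations are within `(6D+1)η`, `(12D+1)η` of their `γ_B`-expectations.  (3) Under `γ_B`
the covariance of the two Gaussians is exactly `2^{-D}((1 − c_n²)^{-D/2} − 1)` (`gauss_covariance_blockLaw`, the tree's
`GaussianProfile.covariance_formula`).  Constants: `C = 4√K|C₀| + 24D + 4`.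

References: S. Chatterjee, arXiv:1602.01222, §§9–11 [arXiv160201222]; E. Meckes, IMS Coll. 5 (2009) 153, §1 [Meckes2009];
E. Seiler, LNP 159 (1982) Ch. 2 [SeilerLNP1982].
-/

set_option autoImplicit false

noncomputable section

open MeasureTheory
open Literature.Probability.LatticeModels Literature.MathematicalPhysics.QuantumLattice
  Literature.MathematicalPhysics.QuantumFieldTheory
open Summit.QuantumFields.YangMills.Theorems.EquipartitionPinsProbe
open Summit.QuantumFields.YangMills.Theorems.WeakCouplingRates (timeShiftLG)

namespace Summit.QuantumFields.YangMills.Theorems.SteinGapBootstrap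

namespace ProbeCovFromPairLaw

/-! ### Elementary real inequalities -/

/-- `|ab − cd| ≤ |a − c| + |b − d|` when `|b| ≤ 1`, `|c| ≤ 1`. [folklore] -/
theorem abs_mul_sub_mul_le {a b c d : ℝ} (hb : |b| ≤ 1) (hc : |c| ≤ 1) :
    |a * b - c * d| ≤ |a - c| + |b - d| := by
  have h : a * b - c * d = (a - c) * b + c * (b - d) := by ring
  rw [h]
  refine (abs_add_le _ _).trans ?_
  rw [abs_mul, abs_mul]
  nlinarith [abs_nonneg (a - c), abs_nonneg (b - d), abs_nonneg b, abs_nonneg c]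

/-- `|p − q + r − s| ≤ |p| + |q| + |r| + |s|`. [folklore] -/
theorem abs_sub_add_sub_le (p q r s : ℝ) : |p - q + r - s| ≤ |p| + |q| + |r| + |s| := by
  have h1 := abs_sub (p - q + r) s
  have h2 := abs_add_le (p - q) r
  have h3 := abs_sub p q
  linarith

/-- **Products under the integral**: for integrable `f, g, f', g'` on a finite measure space with `|g| ≤ 1`, `|f'| ≤ 1`,
`|∫ f g − ∫ f' g'| ≤ ∫ |f − f'| + ∫ |g − g'|`. [folklore] -/
theorem abs_integral_mul_sub_le {Ω : Type*} [MeasurableSpace Ω] (μ : Measure Ω) {f g f' g' : Ω → ℝ}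
    (hf : Integrable f μ) (hg : Integrable g μ) (hf' : Integrable f' μ) (hg' : Integrable g' μ)
    (hfg : Integrable (fun x => f x * g x) μ) (hfg' : Integrable (fun x => f' x * g' x) μ)
    (hgb : ∀ x, |g x| ≤ 1) (hf'b : ∀ x, |f' x| ≤ 1) :
    |(∫ x, f x * g x ∂μ) - ∫ x, f' x * g' x ∂μ| ≤ (∫ x, |f x - f' x| ∂μ) + ∫ x, |g x - g' x| ∂μ := by
  have h1 : Integrable (fun x => |f x - f' x|) μ := (hf.sub hf').abs
  have h2 : Integrable (fun x => |g x - g' x|) μ := (hg.sub hg').abs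
  rw [← integral_sub hfg hfg', ← integral_add h1 h2]
  refine (abs_integral_le_integral_abs).trans (integral_mono_of_nonneg (ae_of_all _ fun x => abs_nonneg _)
    (h1.add h2) (ae_of_all _ fun x => ?_))
  exact abs_mul_sub_mul_le (hgb x) (hf'b x)

/-- **Products of means**: `|∫f ∫g − ∫f' ∫g'| ≤ ∫|f − f'| + ∫|g − g'|` when `|∫ g| ≤ 1`, `|∫ f'| ≤ 1`. [folklore] -/
theorem abs_mul_integral_sub_le {Ω : Type*} [MeasurableSpace Ω] (μ : Measure Ω) {f g f' g' : Ω → ℝ}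
    (hf : Integrable f μ) (hg : Integrable g μ) (hf' : Integrable f' μ) (hg' : Integrable g' μ)
    (hgb : |∫ x, g x ∂μ| ≤ 1) (hf'b : |∫ x, f' x ∂μ| ≤ 1) :
    |(∫ x, f x ∂μ) * (∫ x, g x ∂μ) - (∫ x, f' x ∂μ) * (∫ x, g' x ∂μ)| ≤
      (∫ x, |f x - f' x| ∂μ) + ∫ x, |g x - g' x| ∂μ := by
  refine (abs_mul_sub_mul_le hgb hf'b).trans (add_le_add ?_ ?_)
  · rw [← integral_sub hf hf']; exact abs_integral_le_integral_abs
  · rw [← integral_sub hg hg']; exact abs_integral_le_integral_abs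

end ProbeCovFromPairLaw

open ProbeCovFromPairLaw

/-! ### The crux -/

/-- **Crux `ProbeCovFromPairLawG` (stmt-QuantumFields-23640) of route `SteinGapBootstrap`, by name** — probe covariance from the pair
law under equipartition, with `δ = 1/2`, `β₀ = 1`, `C = 4√K|C₀| + 24D + 4` (`K` the chart constant of `r`, `D = dim G`).
NOT THE CLAY GAP. -/
theorem probeCovFromPairLawG_proof :
    Summit.QuantumFields.YangMills.Theses.SteinGapBootstrap.ProbeCovFromPairLawG := by
  intro G _ _ _ _ _hG
  letI : MeasurableSpace G := borel G
  haveI : BorelSpace G := ⟨rfl⟩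
  intro r C₀
  haveI : T2Space G := (r.continuous.isClosedEmbedding r.injective).isEmbedding.t2Space
  haveI : SecondCountableTopology G :=
    (r.continuous.isClosedEmbedding r.injective).isEmbedding.secondCountableTopology
  obtain ⟨K, hK⟩ := stub_tangentDefect G r
  -- constants
  set D : ℕ := lieDim r with hDdef
  set c₁ : ℝ := 6 * (1 * (D : ℝ)) + 1 with hc₁
  set c₂ : ℝ := 6 * (2 * (D : ℝ)) + 1 with hc₂
  set A : ℝ := Real.sqrt K * |C₀| with hA
  refine ⟨1 / 2, 4 * A + c₂ + 2 * c₁, 1, by norm_num, by positivity, ?_⟩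
  intro β hβ μ hμ hi n hn η hη B YB hH P Dr cn
  have hβ0 : 0 < β := by linarith
  haveI : IsProbabilityMeasure μ := by obtain ⟨_, _, hprob, _⟩ := hμ; exact hprob
  -- the two plaquettes of the pair block
  set p₀ : ZdPlaquette 4 := plaquette12 (d := 4) (by norm_num) 0 with hp₀
  set pn : ZdPlaquette 4 := plaquette12 (d := 4) (by norm_num) (Pi.single (0 : Fin 4) (n : ℤ)) with hpn
  have hne : p₀ ≠ pn := by
    intro h
    have h1 : (0 : Site 4) 0 = (Pi.single (0 : Fin 4) (n : ℤ) : Site 4) 0 := by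
      rw [hp₀, hpn, plaquette12, plaquette12] at h
      exact congrFun (Prod.mk.inj h).1 0
    simp at h1
    omega
  have hB : B = {p₀, pn} := rfl
  have hB0 : p₀ ∈ B := by rw [hB]; simp
  have hBn : pn ∈ B := by rw [hB]; simp
  set q₀ : ↥B := ⟨p₀, hB0⟩ with hq₀
  set qn : ↥B := ⟨pn, hBn⟩ with hqn
  have hcardB : Fintype.card ↥B = 2 := by
    rw [Fintype.card_coe, hB, Finset.card_pair hne]
  -- sums over `↥B` of functions of the plaquette
  have hsumB : ∀ f : ZdPlaquette 4 → ℝ, ∑ p : ↥B, f (p : ZdPlaquette 4) = f p₀ + f pn := fun f => by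
    rw [Finset.sum_coe_sort B f, hB, Finset.sum_pair hne]
  -- the four functions of the configuration
  set Pn : LGConfig 4 G → ℝ := fun U =>
    Real.exp (-2 * max (β * ((r.N : ℝ) - plaquetteObs r.ρ (Pi.single 0 (n : ℤ)) 1 2 U)) 0) with hPn
  set G₀ : LGConfig 4 G → ℝ := fun U => Real.exp (-∑ a, (plaqField r β U p₀ a) ^ 2) with hG₀
  set Gn : LGConfig 4 G → ℝ := fun U => Real.exp (-∑ a, (plaqField r β U pn a) ^ 2) with hGn
  have hPτ : ∀ U, P (timeShiftLG (G := G) n U) = Pn U := fun U => by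
    show Real.exp (-2 * max (β * ((r.N : ℝ) - plaquetteObs r.ρ 0 1 2 (timeShiftLG (G := G) n U))) 0) = _
    rw [plaquetteObs_timeShiftLG]
  -- [0,1]-valued, continuous, integrable
  have hP01 : ∀ U, 0 ≤ P U ∧ P U ≤ 1 := fun U => probe_nonneg_le_one r β 0 U
  have hPn01 : ∀ U, 0 ≤ Pn U ∧ Pn U ≤ 1 := fun U => probe_nonneg_le_one r β _ U
  have hG₀01 : ∀ U, 0 ≤ G₀ U ∧ G₀ U ≤ 1 := fun U => gauss_nonneg_le_one r β 0 U
  have hGn01 : ∀ U, 0 ≤ Gn U ∧ Gn U ≤ 1 := fun U => gauss_nonneg_le_one r β _ U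
  have habs1 : ∀ {f : LGConfig 4 G → ℝ}, (∀ U, 0 ≤ f U ∧ f U ≤ 1) → ∀ U, |f U| ≤ 1 := fun h U => by
    rw [abs_of_nonneg (h U).1]; exact (h U).2
  have hPi : Integrable P μ := integrable_probe r β 0 μ
  have hPni : Integrable Pn μ := integrable_probe r β _ μ
  have hG₀i : Integrable G₀ μ := integrable_gauss r β 0 μ
  have hGni : Integrable Gn μ := integrable_gauss r β _ μ
  have hmul : ∀ {f g : LGConfig 4 G → ℝ}, Continuous f → Continuous g → (∀ U, 0 ≤ f U ∧ f U ≤ 1) →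
      (∀ U, 0 ≤ g U ∧ g U ≤ 1) → Integrable (fun U => f U * g U) μ := fun hf hg hf1 hg1 =>
    Integrable.of_bound (hf.mul hg).aestronglyMeasurable 1 (ae_of_all _ fun U => by
      rw [Real.norm_eq_abs, abs_mul]
      exact mul_le_one₀ (habs1 hf1 U) (abs_nonneg _) (habs1 hg1 U))
  have hPc : Continuous P := continuous_probe r β 0
  have hPnc : Continuous Pn := continuous_probe r β _
  have hG₀c : Continuous G₀ := continuous_gauss r β 0
  have hGnc : Continuous Gn := continuous_gauss r β _
  have hint1 : ∀ {f : LGConfig 4 G → ℝ}, (∀ U, 0 ≤ f U ∧ f U ≤ 1) → |∫ U, f U ∂μ| ≤ 1 := fun h => by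
    rw [abs_of_nonneg (integral_nonneg fun U => (h U).1)]
    calc ∫ U, _ ∂μ ≤ ∫ _U, (1 : ℝ) ∂μ := integral_mono_of_nonneg (ae_of_all _ fun U => (h U).1)
          (integrable_const _) (ae_of_all _ fun U => (h U).2)
      _ = 1 := by simp
  -- (1) probe versus Gaussian of the field, in L¹(μ)
  have hE0 : ∫ U, |P U - G₀ U| ∂μ ≤ Real.sqrt K * C₀ * β ^ (-(1 / 2 : ℝ)) :=
    integral_abs_probe_sub_gauss_le r hK hβ0 μ zero_apply_eq_zero_of_ne (hi 0 1 2 (by decide))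
  have hEn : ∫ U, |Pn U - Gn U| ∂μ ≤ Real.sqrt K * C₀ * β ^ (-(1 / 2 : ℝ)) :=
    integral_abs_probe_sub_gauss_le r hK hβ0 μ (single_apply_eq_zero_of_ne (n : ℤ)) (hi _ 1 2 (by decide))
  have hA' : Real.sqrt K * C₀ * β ^ (-(1 / 2 : ℝ)) ≤ A * β ^ (-(1 / 2 : ℝ)) :=
    mul_le_mul_of_nonneg_right (mul_le_mul_of_nonneg_left (le_abs_self C₀) (Real.sqrt_nonneg K))
      (Real.rpow_nonneg hβ0.le _)
  have h1 : |(∫ U, P U * Pn U ∂μ) - ∫ U, G₀ U * Gn U ∂μ| ≤ 2 * (A * β ^ (-(1 / 2 : ℝ))) := by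
    have h := abs_integral_mul_sub_le μ hPi hPni hG₀i hGni (hmul hPc hPnc hP01 hPn01)
      (hmul hG₀c hGnc hG₀01 hGn01) (habs1 hPn01) (habs1 hG₀01)
    linarith
  have h2 : |(∫ U, P U ∂μ) * (∫ U, Pn U ∂μ) - (∫ U, G₀ U ∂μ) * (∫ U, Gn U ∂μ)| ≤ 2 * (A * β ^ (-(1 / 2 : ℝ))) := by
    have h := abs_mul_integral_sub_le μ hPi hPni hG₀i hGni (hint1 hPn01) (hint1 hG₀01)
    linarith
  -- (2) the admissible Gaussian test functions
  have hD : Fintype.card (Fin (lieDim r)) = D := Fintype.card_fin _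
  obtain ⟨hU1, hU2, hU3⟩ := gaussTest_admissible (ι := ↥B) (κ := Fin (lieDim r)) Finset.univ
  obtain ⟨h01, h02, h03⟩ := gaussTest_admissible (ι := ↥B) (κ := Fin (lieDim r)) {q₀}
  obtain ⟨hn1, hn2, hn3⟩ := gaussTest_admissible (ι := ↥B) (κ := Fin (lieDim r)) {qn}
  have hcU : (6 * ((Finset.univ : Finset ↥B).card * Fintype.card (Fin (lieDim r)) : ℝ) + 1) = c₂ := by
    rw [Finset.card_univ, hcardB, hD]; norm_num [hc₂]
  have hc0 : (6 * (({q₀} : Finset ↥B).card * Fintype.card (Fin (lieDim r)) : ℝ) + 1) = c₁ := by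
    rw [Finset.card_singleton, hD]; norm_num [hc₁]
  have hcn : (6 * (({qn} : Finset ↥B).card * Fintype.card (Fin (lieDim r)) : ℝ) + 1) = c₁ := by
    rw [Finset.card_singleton, hD]; norm_num [hc₁]
  rw [hcU] at hU1 hU2 hU3
  rw [hc0] at h01 h02 h03
  rw [hcn] at hn1 hn2 hn3
  have HU := hH _ hU1 hU2 hU3
  have H0 := hH _ h01 h02 h03
  have Hn := hH _ hn1 hn2 hn3
  have hc₁0 : 0 < c₁ := by positivity
  have hc₂0 : 0 < c₂ := by positivity
  -- unscale: `|∫ f dμ∘Y − ∫ f dγ| ≤ c η`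
  have unscale : ∀ {c : ℝ} (hc : 0 < c) {f : (↥B → Fin (lieDim r) → ℝ) → ℝ},
      |(∫ U, c⁻¹ * f (YB U) ∂μ) - ∫ z, c⁻¹ * f z ∂latticeMaxwellBlockLaw B (lieDim r)| ≤ η →
      |(∫ U, f (YB U) ∂μ) - ∫ z, f z ∂latticeMaxwellBlockLaw B (lieDim r)| ≤ c * η := by
    intro c hc f h
    rw [integral_const_mul, integral_const_mul, ← mul_sub, abs_mul, abs_inv, abs_of_pos hc,
      inv_mul_le_iff₀ hc] at h
    exact h
  have HU' := unscale hc₂0 (f := fun y => Real.exp (-∑ p ∈ (Finset.univ : Finset ↥B), ∑ a, (y p a) ^ 2)) HU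
  have H0' := unscale hc₁0 (f := fun y => Real.exp (-∑ p ∈ ({q₀} : Finset ↥B), ∑ a, (y p a) ^ 2)) H0
  have Hn' := unscale hc₁0 (f := fun y => Real.exp (-∑ p ∈ ({qn} : Finset ↥B), ∑ a, (y p a) ^ 2)) Hn
  -- identify the integrands on the μ side
  have eU : ∀ U, Real.exp (-∑ p ∈ (Finset.univ : Finset ↥B), ∑ a, (YB U p a) ^ 2) = G₀ U * Gn U := fun U => by
    show Real.exp (-∑ p ∈ (Finset.univ : Finset ↥B), ∑ a, (plaqField r β U (p : ZdPlaquette 4) a) ^ 2) = _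
    rw [hsumB (fun p => ∑ a, (plaqField r β U p a) ^ 2), neg_add, Real.exp_add]
  have e0 : ∀ U, Real.exp (-∑ p ∈ ({q₀} : Finset ↥B), ∑ a, (YB U p a) ^ 2) = G₀ U := fun U => by
    rw [Finset.sum_singleton]
  have en : ∀ U, Real.exp (-∑ p ∈ ({qn} : Finset ↥B), ∑ a, (YB U p a) ^ 2) = Gn U := fun U => by
    rw [Finset.sum_singleton]
  simp_rw [eU] at HU'
  simp_rw [e0] at H0'
  simp_rw [en] at Hn'
  -- (3) the Gaussian side
  set J : ℝ := ∫ z, Real.exp (-∑ p ∈ (Finset.univ : Finset ↥B), ∑ a, (z p a) ^ 2)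
    ∂latticeMaxwellBlockLaw B (lieDim r) with hJ
  set J0 : ℝ := ∫ z, Real.exp (-∑ a, (z q₀ a) ^ 2) ∂latticeMaxwellBlockLaw B (lieDim r) with hJ0
  set Jn : ℝ := ∫ z, Real.exp (-∑ a, (z qn a) ^ 2) ∂latticeMaxwellBlockLaw B (lieDim r) with hJn
  simp only [Finset.sum_singleton] at H0' Hn'
  change |(∫ U, G₀ U ∂μ) - J0| ≤ c₁ * η at H0'
  change |(∫ U, Gn U ∂μ) - Jn| ≤ c₁ * η at Hn'
  have hJprod : J = ∫ z, Real.exp (-∑ a, (z q₀ a) ^ 2) * Real.exp (-∑ a, (z qn a) ^ 2)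
      ∂latticeMaxwellBlockLaw B (lieDim r) := by
    rw [hJ, integral_latticeMaxwellBlockLaw B (lieDim r) _ (Continuous.aestronglyMeasurable (by fun_prop)),
      integral_gauss_mul_gauss_blockLaw]
    refine integral_congr_ae (ae_of_all _ fun ω => ?_)
    show Real.exp (-∑ p ∈ (Finset.univ : Finset ↥B), ∑ a, (ω (p : ZdPlaquette 4) a) ^ 2) = _
    rw [hsumB (fun p => ∑ a, (ω p a) ^ 2), neg_add, Real.exp_add]
  have hCov : J - J0 * Jn = (2 : ℝ) ^ (-(D : ℝ)) * ((1 - cn ^ 2) ^ (-((D : ℝ) / 2)) - 1) := by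
    rw [hJprod]
    exact gauss_covariance_blockLaw B (lieDim r) q₀ qn
  have hJ0b : |J0| ≤ 1 := by
    obtain ⟨h0, h1⟩ := integral_gauss_blockLaw_mem B (lieDim r) q₀
    rw [abs_of_nonneg h0]; exact h1
  -- (4) products of means on the Gaussian side
  have h4 : |(∫ U, G₀ U ∂μ) * (∫ U, Gn U ∂μ) - J0 * Jn| ≤ c₁ * η + c₁ * η :=
    (abs_mul_sub_mul_le (hint1 hGn01) hJ0b).trans (add_le_add H0' Hn')
  -- assemble
  have hDr : Dr = (D : ℝ) := rfl
  have hb : 0 ≤ β ^ (-(1 / 2 : ℝ)) := Real.rpow_nonneg hβ0.le _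
  have hA0 : 0 ≤ A := by positivity
  have t1 : (c₂ + 2 * c₁) * η ≤ (4 * A + c₂ + 2 * c₁) * η := mul_le_mul_of_nonneg_right (by linarith) hη
  have t2 : 4 * A * β ^ (-(1 / 2 : ℝ)) ≤ (4 * A + c₂ + 2 * c₁) * β ^ (-(1 / 2 : ℝ)) :=
    mul_le_mul_of_nonneg_right (by linarith) hb
  have hgoal : |((∫ U, P U * P (timeShiftLG (G := G) n U) ∂μ) -
      (∫ U, P U ∂μ) * (∫ U, P (timeShiftLG (G := G) n U) ∂μ)) -
      (2 : ℝ) ^ (-Dr) * ((1 - cn ^ 2) ^ (-(Dr / 2)) - 1)| ≤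
      (4 * A + c₂ + 2 * c₁) * η + (4 * A + c₂ + 2 * c₁) * β ^ (-(1 / 2 : ℝ)) := by
    simp_rw [hPτ]
    rw [hDr, ← hCov]
    have key : ((∫ U, P U * Pn U ∂μ) - (∫ U, P U ∂μ) * (∫ U, Pn U ∂μ)) - (J - J0 * Jn) =
        ((∫ U, P U * Pn U ∂μ) - ∫ U, G₀ U * Gn U ∂μ) -
          ((∫ U, P U ∂μ) * (∫ U, Pn U ∂μ) - (∫ U, G₀ U ∂μ) * (∫ U, Gn U ∂μ)) +
          ((∫ U, G₀ U * Gn U ∂μ) - J) - ((∫ U, G₀ U ∂μ) * (∫ U, Gn U ∂μ) - J0 * Jn) := by ring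
    rw [key]
    refine (abs_sub_add_sub_le _ _ _ _).trans ?_
    linarith [h1, h2, HU', h4, t1, t2]
  exact hgoal

/-- **Item `UProbeCovFromPairLaw` (stmt-QuantumFields-23800), by name**: in the split of U = `FreeProbeLawG` the third child is, by
definition (route file), the decl `ProbeCovFromPairLawG`; it is closed by `probeCovFromPairLawG_proof`.  NOT THE CLAY GAP. -/
theorem uProbeCovFromPairLaw_proof :
    Summit.QuantumFields.YangMills.Theses.SteinGapBootstrap.UProbeCovFromPairLaw :=
  probeCovFromPairLawG_proof

end Summit.QuantumFields.YangMills.Theorems.SteinGapBootstrap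

end
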